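import Mathlib

/-!
# Hodge-locus census — PROPOSITION SM-2: the hand steps of the smoothness certificate of an explicit member of `π⁻¹(Σ°)` in the cell `(8, 4, 3)`

certified instances and evidence bearing on the general Hodge conjecture; no claim.

pub-hlocus ENGINE B (seat ivhs-2), gen 34, record `pub-hlocus-ivhs-2/ENGINEB-g34.md` §1 (def-free, notation-free helper of
`stmt-HodgeConjecture-16267`; companion of `HodgeLocusCensusJumpStratum.lean` … `HodgeLocusCensusJumpOrderings.lean`).

The member (record §1): on `ℙ⁹` with coordinates `(a, b, x₀..x₃, y₀..y₃)`,
  `F = y₀(x₀³ − x₁²x₂) + y₁(x₁³ − x₂²x₃) + y₂(x₂³ − x₀x₃²) + y₃x₃³ + y₀⁴ + y₁⁴ + y₂⁴ + y₃⁴ + ab(x₀x₁ + a² + b²)`,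
`G := F|_{a=b=0}`, `g := x₀x₁`, `h = (x₀³ − x₁²x₂, x₁³ − x₂²x₃, x₂³ − x₀x₃², x₃³)`.
KERNEL-CHECKED HERE (pure commutative algebra over a field / commutative ring; no geometry):
* `kernel_identity` : `x₁h₀ + x₂h₁ + x₃h₂ + x₀h₃ = g·x₀²` — the vector `((x₁,x₂,x₃,x₀); x₀²)` lies in the kernel of `Φ_{(h;g)}`, so `b(F) ≥ 1`
  (that it spans the kernel, `b = 1`, is the rank computation of the record, not checked here);
* (the closed forms `∂F/∂a = b(x₀x₁ + 3a² + b²)`, `∂F/∂b = a(x₀x₁ + a² + 3b²)` are checked as polynomial identities by BOTH implementations of the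
  record, not here; the case split below uses only the algebra of these two expressions)
* `case_split` : over a field with `2 ≠ 0`, `b(g + 3a² + b²) = 0 ∧ a(g + a² + 3b²) = 0 → a = 0 ∨ b = 0 ∨ (b² = a² ∧ g = -4a²)`;
* `caseIV_grad_x0`, `caseIV_grad_x1` : under the case-IV relations `b = εa`, `ε² = 1`, `x₀x₁ = -4a²` (and `8 ≠ 0`), the `x₀`- and `x₁`-partials of `F`
  equal those of `G − (ε/8)g²`:  `a b x₁ + P = P − (ε/8)·(2 x₀ x₁²)` etc. (the other partials agree trivially) — LEMMA G_ε of the record;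
* `cone_x3_zero` : for every `c`, the gradient system of `Φ_c := G + c·x₀²x₁²` has no nonzero solution with `x₃ = 0` over any field with
  `2 ≠ 0`, `3 ≠ 0` — the `x₃ = 0` half of each of the three CONE LEMMAS (`c = 0, ∓1/8`); the `x₃ ≠ 0` half is the Gröbner computation of the record
  (two implementations, two primes) and is NOT kernel-checked.
-/

namespace Summit.HodgeConjecture.HodgeConjecture.HodgeLocus.Census.SigmaMember

/-- The rank-jump witness: `((ℓ₀,ℓ₁,ℓ₂,ℓ₃); q) = ((x₁,x₂,x₃,x₀); x₀²)` satisfies `Σ ℓ_j h_j = g q` (it telescopes). -/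
theorem kernel_identity {R : Type*} [CommRing R] (x0 x1 x2 x3 : R) :
    x1 * (x0 ^ 3 - x1 ^ 2 * x2) + x2 * (x1 ^ 3 - x2 ^ 2 * x3) + x3 * (x2 ^ 3 - x0 * x3 ^ 2) + x0 * x3 ^ 3
      = (x0 * x1) * x0 ^ 2 := by
  ring

/-- The root identity behind the case split: `b·∂F/∂b − a·∂F/∂a = 2ab(b² − a²)` for the displayed closed forms. -/
theorem root_identity {R : Type*} [CommRing R] (a b g : R) :
    b * (a * (g + a ^ 2 + 3 * b ^ 2)) - a * (b * (g + 3 * a ^ 2 + b ^ 2)) = 2 * a * b * (b ^ 2 - a ^ 2) := by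
  ring

/-- CASE SPLIT.  If `∂F/∂a = b(g + 3a² + b²) = 0` and `∂F/∂b = a(g + a² + 3b²) = 0` then `a = 0`, or `b = 0`, or (`b² = a²` and `g = -4a²`). -/
theorem case_split {K : Type*} [Field K] (h2 : (2 : K) ≠ 0) (a b g : K)
    (Ea : b * (g + 3 * a ^ 2 + b ^ 2) = 0) (Eb : a * (g + a ^ 2 + 3 * b ^ 2) = 0) :
    a = 0 ∨ b = 0 ∨ (b ^ 2 = a ^ 2 ∧ g = -4 * a ^ 2) := by
  by_cases ha : a = 0
  · exact Or.inl ha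
  by_cases hb : b = 0
  · exact Or.inr (Or.inl hb)
  right; right
  have Ea' : g + 3 * a ^ 2 + b ^ 2 = 0 := by
    rcases mul_eq_zero.mp Ea with h | h
    · exact absurd h hb
    · exact h
  have Eb' : g + a ^ 2 + 3 * b ^ 2 = 0 := by
    rcases mul_eq_zero.mp Eb with h | h
    · exact absurd h ha
    · exact h
  have hsq : 2 * (b ^ 2 - a ^ 2) = 0 := by linear_combination Eb' - Ea'
  have hsq' : b ^ 2 - a ^ 2 = 0 := by
    rcases mul_eq_zero.mp hsq with h | h
    · exact absurd h h2
    · exact h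
  constructor
  · linear_combination hsq'
  · linear_combination Ea' - hsq'

/-- LEMMA G_ε, `x₀`-component: under `x₀x₁ = -4a²`, the term `a·b·x₁ = ε a² x₁` of `∂F/∂x₀` equals the `x₀`-partial `-(ε/8)·2x₀x₁²`
of `-(ε/8)(x₀x₁)²`; so `∂F/∂x₀(a, εa, x, y) = ∂(G − (ε/8)g²)/∂x₀`.  Stated for the extra terms only (`P` = the common part `∂G/∂x₀`). -/
theorem caseIV_grad_x0 {K : Type*} [Field K] (h8 : (8 : K) ≠ 0) (ε a x0 x1 P : K)
    (hrel : x0 * x1 = -4 * a ^ 2) :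
    a * (ε * a) * x1 + P = P - ε / 8 * (2 * x0 * x1 ^ 2) := by
  have h : ε / 8 * (2 * x0 * x1 ^ 2) = ε / 8 * 2 * (x0 * x1) * x1 := by ring
  rw [h, hrel]
  field_simp
  ring

/-- LEMMA G_ε, `x₁`-component (symmetric). -/
theorem caseIV_grad_x1 {K : Type*} [Field K] (h8 : (8 : K) ≠ 0) (ε a x0 x1 P : K)
    (hrel : x0 * x1 = -4 * a ^ 2) :
    a * (ε * a) * x0 + P = P - ε / 8 * (2 * x0 ^ 2 * x1) := by
  have h : ε / 8 * (2 * x0 ^ 2 * x1) = ε / 8 * 2 * (x0 * x1) * x0 := by ring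
  rw [h, hrel]
  field_simp
  ring

/-- In a field (indeed a reduced ring), `u ^ 3 = 0 → u = 0`. -/
private lemma cube_zero {K : Type*} [Field K] {u : K} (h : u ^ 3 = 0) : u = 0 := pow_eq_zero_iff (n := 3) (by norm_num) |>.mp h

/-- CONE LEMMAS, the `x₃ = 0` half (all `c` at once).  The gradient system of `Φ_c = Σ y_j h_j + Σ y_j⁴ + c x₀²x₁²`:
`P0..P3` are `∂/∂x₀..∂/∂x₃`, `Q0..Q3` are `∂/∂y₀..∂/∂y₃`.  With `x₃ = 0` it forces `x = y = 0`. -/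
theorem cone_x3_zero {K : Type*} [Field K] (h2 : (2 : K) ≠ 0) (h3 : (3 : K) ≠ 0)
    (c x0 x1 x2 x3 y0 y1 y2 y3 : K) (hx3 : x3 = 0)
    (P0 : 3 * x0 ^ 2 * y0 - x3 ^ 2 * y2 + 2 * c * x0 * x1 ^ 2 = 0)
    (P1 : -2 * x1 * x2 * y0 + 3 * x1 ^ 2 * y1 + 2 * c * x0 ^ 2 * x1 = 0)
    (P2 : -x1 ^ 2 * y0 - 2 * x2 * x3 * y1 + 3 * x2 ^ 2 * y2 = 0)
    (P3 : -x2 ^ 2 * y1 - 2 * x0 * x3 * y2 + 3 * x3 ^ 2 * y3 = 0)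
    (Q0 : x0 ^ 3 - x1 ^ 2 * x2 + 4 * y0 ^ 3 = 0) (Q1 : x1 ^ 3 - x2 ^ 2 * x3 + 4 * y1 ^ 3 = 0)
    (Q2 : x2 ^ 3 - x0 * x3 ^ 2 + 4 * y2 ^ 3 = 0) (Q3 : x3 ^ 3 + 4 * y3 ^ 3 = 0) :
    x0 = 0 ∧ x1 = 0 ∧ x2 = 0 ∧ y0 = 0 ∧ y1 = 0 ∧ y2 = 0 ∧ y3 = 0 := by
  subst hx3
  have h4 : (4 : K) ≠ 0 := by
    have e : (4 : K) = 2 * 2 := by norm_num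
    rw [e]; exact mul_ne_zero h2 h2
  -- y3 = 0
  have hy3 : y3 = 0 := by
    have h : 4 * y3 ^ 3 = 0 := by linear_combination Q3
    rcases mul_eq_zero.mp h with h | h
    · exact absurd h h4
    · exact cube_zero h
  -- P3 gives x2² y1 = 0
  have hP3 : x2 ^ 2 * y1 = 0 := by linear_combination -P3
  rcases mul_eq_zero.mp hP3 with hx2sq | hy1
  · -- case x2 = 0
    have hx2 : x2 = 0 := pow_eq_zero_iff (n := 2) (by norm_num) |>.mp hx2sq
    subst hx2
    have hy2 : y2 = 0 := by
      have h : 4 * y2 ^ 3 = 0 := by linear_combination Q2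
      rcases mul_eq_zero.mp h with h | h
      · exact absurd h h4
      · exact cube_zero h
    subst hy2
    have hP2 : x1 ^ 2 * y0 = 0 := by linear_combination -P2
    rcases mul_eq_zero.mp hP2 with hx1sq | hy0
    · have hx1 : x1 = 0 := pow_eq_zero_iff (n := 2) (by norm_num) |>.mp hx1sq
      subst hx1
      have hy1 : y1 = 0 := by
        have h : 4 * y1 ^ 3 = 0 := by linear_combination Q1
        rcases mul_eq_zero.mp h with h | h
        · exact absurd h h4
        · exact cube_zero h
      have hP0 : 3 * x0 ^ 2 * y0 = 0 := by linear_combination P0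
      have hx0y0 : x0 = 0 ∨ y0 = 0 := by
        rcases mul_eq_zero.mp hP0 with h | h
        · rcases mul_eq_zero.mp h with h | h
          · exact absurd h h3
          · exact Or.inl (pow_eq_zero_iff (n := 2) (by norm_num) |>.mp h)
        · exact Or.inr h
      rcases hx0y0 with hx0 | hy0
      · subst hx0
        have hy0 : y0 = 0 := by
          have h : 4 * y0 ^ 3 = 0 := by linear_combination Q0
          rcases mul_eq_zero.mp h with h | h
          · exact absurd h h4
          · exact cube_zero h
        exact ⟨rfl, rfl, rfl, hy0, hy1, rfl, hy3⟩
      · subst hy0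
        have hx0 : x0 = 0 := by
          have h : x0 ^ 3 = 0 := by linear_combination Q0
          exact cube_zero h
        exact ⟨hx0, rfl, rfl, rfl, hy1, rfl, hy3⟩
    · subst hy0
      have hx0 : x0 = 0 := by
        have h : x0 ^ 3 = 0 := by linear_combination Q0
        exact cube_zero h
      subst hx0
      have hP1 : 3 * x1 ^ 2 * y1 = 0 := by linear_combination P1
      have hx1y1 : x1 = 0 ∨ y1 = 0 := by
        rcases mul_eq_zero.mp hP1 with h | h
        · rcases mul_eq_zero.mp h with h | h
          · exact absurd h h3
          · exact Or.inl (pow_eq_zero_iff (n := 2) (by norm_num) |>.mp h)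
        · exact Or.inr h
      rcases hx1y1 with hx1 | hy1
      · subst hx1
        have hy1 : y1 = 0 := by
          have h : 4 * y1 ^ 3 = 0 := by linear_combination Q1
          rcases mul_eq_zero.mp h with h | h
          · exact absurd h h4
          · exact cube_zero h
        exact ⟨rfl, rfl, rfl, rfl, hy1, rfl, hy3⟩
      · subst hy1
        have hx1 : x1 = 0 := by
          have h : x1 ^ 3 = 0 := by linear_combination Q1
          exact cube_zero h
        exact ⟨rfl, hx1, rfl, rfl, rfl, rfl, hy3⟩
  · -- case y1 = 0
    subst hy1
    have hx1 : x1 = 0 := by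
      have h : x1 ^ 3 = 0 := by linear_combination Q1
      exact cube_zero h
    subst hx1
    have hP2 : 3 * x2 ^ 2 * y2 = 0 := by linear_combination P2
    have hx2y2 : x2 = 0 ∨ y2 = 0 := by
      rcases mul_eq_zero.mp hP2 with h | h
      · rcases mul_eq_zero.mp h with h | h
        · exact absurd h h3
        · exact Or.inl (pow_eq_zero_iff (n := 2) (by norm_num) |>.mp h)
      · exact Or.inr h
    have hx2 : x2 = 0 ∧ y2 = 0 := by
      rcases hx2y2 with hx2 | hy2
      · subst hx2
        have h : 4 * y2 ^ 3 = 0 := by linear_combination Q2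
        rcases mul_eq_zero.mp h with h | h
        · exact absurd h h4
        · exact ⟨rfl, cube_zero h⟩
      · subst hy2
        have h : x2 ^ 3 = 0 := by linear_combination Q2
        exact ⟨cube_zero h, rfl⟩
    obtain ⟨hx2', hy2'⟩ := hx2
    subst hx2' hy2'
    have hP0 : 3 * x0 ^ 2 * y0 = 0 := by linear_combination P0
    have hx0y0 : x0 = 0 ∨ y0 = 0 := by
      rcases mul_eq_zero.mp hP0 with h | h
      · rcases mul_eq_zero.mp h with h | h
        · exact absurd h h3
        · exact Or.inl (pow_eq_zero_iff (n := 2) (by norm_num) |>.mp h)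
      · exact Or.inr h
    have hx0 : x0 = 0 ∧ y0 = 0 := by
      rcases hx0y0 with hx0 | hy0
      · subst hx0
        have h : 4 * y0 ^ 3 = 0 := by linear_combination Q0
        rcases mul_eq_zero.mp h with h | h
        · exact absurd h h4
        · exact ⟨rfl, cube_zero h⟩
      · subst hy0
        have h : x0 ^ 3 = 0 := by linear_combination Q0
        exact ⟨cube_zero h, rfl⟩
    obtain ⟨hx0', hy0'⟩ := hx0
    exact ⟨hx0', rfl, rfl, hy0', rfl, rfl, hy3⟩

end Summit.HodgeConjecture.HodgeConjecture.HodgeLocus.Census.SigmaMember
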